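import Literature.Computability.AlgebraicComplexity.TableauEvalLayerSlicing
import HarnessLib

/-!
# Banded merges of slice outputs (key-range pieces), in meaning

Glue file (cell `val-lit`, DIP20 lane, unit val-lit-x4 g7; theorems only, no definition, no named fact)
for the kernel certificates of Dörfler–Ikenmeyer–Panova 2020, Prop. 5.1, `Ch_4^7` half
(`DIP20Prop51Certificates47*.lean`). It extends val-lit-t05 g7's `TableauEvalLayerSlicing.lean`
(input-layer slicing of a fat label, merge of the slice outputs given IN MEANING to
`layerSum_layersS_slices_spec_tableTrie`).

Why. The generator of record re-sorts and merges the slice outputs `M₁, …, Mₘ` of a fat label by a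
TREE of kernel merges `compressA (msortK d [..].flatten) = node` whose ROOT materialises the whole next
layer `N`; when `N` has ≳ 3 000 states and the slice outputs overlap, the root (and the last tree level)
take `2–3 · |N|` input entries — beyond one gate elaboration (x4 g7 census 2026-08-27: 24 of the 40
remaining rows of DIP's set `X` have such a merge). **Banded merging** cuts the OUTPUT key space into
bands instead: every slice output `Mᵢ` (sorted by key) is the concatenation of its key-range pieces
`P i b`, one kernel merge per band `b` adds up the pieces `P 1 b, …, P m b` of all slices to the band
`B_b` of `N` (itself a `drop/take` piece of the literal `N`), and `N` is the concatenation of its bands.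
Every entry is merged exactly once and every kernel merge is as small as the band.

Content (pure bookkeeping over `layerSpec`, [cite: DorflerIkenmeyerPanova2020, §5 (proof of Prop. 5.1,
arXiv pp. 12–13)] for the programme it serves; the algebra is folklore):
* `sum_layerSpec_rows` — rows of pieces flatten to the slice outputs ⇒ the row-major double sum of
  `layerSpec` over the pieces is the sum over the slice outputs;
* `map_getD_range`, `sum_rows_eq_sum_cols` — commuting a rectangular double `List` sum (rows ↔ columns,
  columns read by `List.getD b []`);
* `sum_layerSpec_bands` — one `layerSpec_merge_node` per band;
* **`layerSpec_merge_banded`** — the merge hypothesis `hM` of `layerSum_layersS_slices_spec(_tableTrie)`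
  from: the row equalities `[P i 1, …, P i r].flatten = Mᵢ`, the band merges
  `compressA (msortK d [P 1 b, …, P m b].flatten) = B_b` (stated through `List.getD b []` on the piece
  matrix so that no transpose is needed), and `[B_1, …, B_r].flatten = N`.

Honest framing: filing mechanics for a toy-model computation (Chow variety `Ch_4^7` versus power sums);
nothing here bears on permanent versus determinant; VP ≠ VNP is NOT proved.

## References
* J. Dörfler, C. Ikenmeyer, G. Panova, *On geometric complexity theory: multiplicity obstructions are
  stronger than occurrence obstructions*, SIAM J. Appl. Algebra Geom. 4 (2020) = arXiv:1901.04576, §5.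
  [DorflerIkenmeyerPanova2020]

## Mathlib and tree
Tree: `layerSpec`, `layerSpec_flatten`, `layerSpec_merge_node` (`TableauEvalLayerSlicing`, val-lit-t05 g7;
`TableauEvalLabelMajorImpl`), `compressA`, `msortK` (`TableauEvalLabelMajorSymm` / `TableauEvalKeyedLayers`).
Mathlib: `List.sum_map_add`, `List.range_succ_eq_map`, `List.Forall₂`.
-/

namespace Literature.Computability.AlgebraicComplexity

namespace TableauEval

section Banded

variable {R : Type*} [CommRing R]

/-- Rows: if every row of pieces flattens to its slice output, the sum of `layerSpec` over the slice
outputs is the row-major double sum over the pieces. [cite: DorflerIkenmeyerPanova2020, §5 (proof of Prop. 5.1, arXiv pp. 12–13)] -/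
theorem sum_layerSpec_rows (S : List ℕ → R) (cols : List Column) (u n : ℕ) :
    ∀ {Ms : List (List (ℕ × List (List ℕ) × R))} {Pss : List (List (List (ℕ × List (List ℕ) × R)))},
      List.Forall₂ (fun M Ps => Ps.flatten = M) Ms Pss →
      (Ms.map (layerSpec S cols u n)).sum =
        (Pss.map fun Ps => (Ps.map (layerSpec S cols u n)).sum).sum
  | _, _, List.Forall₂.nil => rfl
  | _, _, List.Forall₂.cons (a := M) (b := Ps) h hrest => by
    rw [List.map_cons, List.sum_cons, List.map_cons, List.sum_cons, ← h, layerSpec_flatten,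
      sum_layerSpec_rows S cols u n hrest]

/-- Reading a list position by position (`List.getD`) over `range length` returns the list. [folklore] -/
private theorem map_getD_range {α : Type*} (d : α) :
    ∀ Ps : List α, (List.range Ps.length).map (fun b => Ps.getD b d) = Ps
  | [] => rfl
  | p :: Ps => by
    rw [List.length_cons, List.range_succ_eq_map, List.map_cons, List.map_map]
    have hcomp : ((fun b => (p :: Ps).getD b d) ∘ Nat.succ) = fun b => Ps.getD b d := by
      funext b
      simp
    rw [hcomp, map_getD_range d Ps]
    simp

/-- Commuting a rectangular double `List` sum: rows of common length `r` against the columns read by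
`List.getD b d`, `b < r`. [folklore] -/
private theorem sum_rows_eq_sum_cols {α : Type*} (f : α → R) (d : α) (r : ℕ) :
    ∀ Pss : List (List α), (∀ Ps ∈ Pss, Ps.length = r) →
      (Pss.map fun Ps => (Ps.map f).sum).sum =
        ((List.range r).map fun b => ((Pss.map fun Ps => Ps.getD b d).map f).sum).sum
  | [], _ => by simp
  | Ps :: Pss, hr => by
    have hPs : Ps.length = r := hr Ps (by simp)
    have hrest : ∀ Qs ∈ Pss, Qs.length = r := fun Qs h => hr Qs (by simp [h])
    rw [List.map_cons, List.sum_cons, sum_rows_eq_sum_cols f d r Pss hrest]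
    have hsplit : ((List.range r).map fun b => (((Ps :: Pss).map fun Qs => Qs.getD b d).map f).sum) =
        (List.range r).map (fun b => f (Ps.getD b d) + ((Pss.map fun Qs => Qs.getD b d).map f).sum) := by
      refine List.map_congr_left fun b _ => ?_
      rw [List.map_cons, List.map_cons, List.sum_cons]
    rw [hsplit, List.sum_map_add]
    congr 1
    rw [← hPs]
    conv_lhs => rw [← map_getD_range d Ps, List.map_map]
    rfl

/-- Bands: one `layerSpec_merge_node` per band `b`: if the column `col b` of pieces merges in the
kernel to the band `B_b`, the `layerSpec` of the bands add up to the column-major double sum.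
[cite: DorflerIkenmeyerPanova2020, §5 (proof of Prop. 5.1, arXiv pp. 12–13)] -/
theorem sum_layerSpec_bands (S : List ℕ → R) (cols : List Column) (u n d : ℕ)
    (col : ℕ → List (List (ℕ × List (List ℕ) × R))) :
    ∀ {bs : List ℕ} {Bs : List (List (ℕ × List (List ℕ) × R))},
      List.Forall₂ (fun b B => compressA (msortK d (col b).flatten) = B) bs Bs →
      (Bs.map (layerSpec S cols u n)).sum =
        (bs.map fun b => ((col b).map (layerSpec S cols u n)).sum).sum
  | _, _, List.Forall₂.nil => rfl
  | _, _, List.Forall₂.cons (a := b) (b := B) h hrest => by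
    rw [List.map_cons, List.sum_cons, List.map_cons, List.sum_cons,
      layerSpec_merge_node S cols u n d (col b) B h, sum_layerSpec_bands S cols u n d col hrest]

/-- **Banded merge, in meaning.** Slice outputs `Ms = [M₁, …, Mₘ]`; a piece matrix `Pss` whose row `i`
(of length `r`) flattens to `Mᵢ`; for every band `b < r` one kernel merge of the column
`Pss.map (·.getD b [])` to the band `B_b`; and the bands flatten to the next layer `N`. Then
`layerSpec N = ∑ᵢ layerSpec Mᵢ` — the hypothesis `hM` of `layerSum_layersS_slices_spec(_tableTrie)`
(with `.symm`). [cite: DorflerIkenmeyerPanova2020, §5 (proof of Prop. 5.1, arXiv pp. 12–13)] -/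
theorem layerSpec_merge_banded (S : List ℕ → R) (cols : List Column) (u n d r : ℕ)
    (Ms : List (List (ℕ × List (List ℕ) × R))) (Pss : List (List (List (ℕ × List (List ℕ) × R))))
    (Bs : List (List (ℕ × List (List ℕ) × R))) (N : List (ℕ × List (List ℕ) × R))
    (hP : List.Forall₂ (fun M Ps => Ps.flatten = M) Ms Pss)
    (hr : ∀ Ps ∈ Pss, Ps.length = r)
    (hB : List.Forall₂ (fun b B => compressA (msortK d (Pss.map fun Ps => Ps.getD b []).flatten) = B)
      (List.range r) Bs)
    (hN : Bs.flatten = N) :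
    layerSpec S cols u n N = (Ms.map (layerSpec S cols u n)).sum := by
  rw [sum_layerSpec_rows S cols u n hP, sum_rows_eq_sum_cols (layerSpec S cols u n) [] r Pss hr, ← hN,
    layerSpec_flatten]
  exact sum_layerSpec_bands S cols u n d (fun b => Pss.map fun Ps => Ps.getD b []) hB

end Banded

/-! ## Sanity (kernel): a two-slice, two-band toy merge -/

/-- Two "slice outputs" over one column, cut into two key bands each; the two band merges and the
row / band concatenations feed `layerSpec_merge_banded` (statement-level exercise of the plumbing the
generated certificate files use: row equalities by `decide`, band merges by `decide`, lengths by `decide`). [folklore] -/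
example (S : List ℕ → ℤ) (cols : List Column) (u n : ℕ) :
    let M₁ : List (ℕ × List (List ℕ) × ℤ) := [(1, [[0]], 2), (5, [[1]], 3)]
    let M₂ : List (ℕ × List (List ℕ) × ℤ) := [(1, [[0]], 4), (6, [[2]], 1)]
    let N : List (ℕ × List (List ℕ) × ℤ) := [(1, [[0]], 6), (5, [[1]], 3), (6, [[2]], 1)]
    layerSpec S cols u n N = ([M₁, M₂].map (layerSpec S cols u n)).sum := by
  intro M₁ M₂ N
  exact layerSpec_merge_banded S cols u n 64 2 [M₁, M₂]
    [[(M₁.drop 0).take 1, (M₁.drop 1).take 1], [(M₂.drop 0).take 1, (M₂.drop 1).take 1]]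
    [(N.drop 0).take 1, (N.drop 1).take 2] N
    (List.Forall₂.cons (by decide) (List.Forall₂.cons (by decide) List.Forall₂.nil))
    (by decide)
    (List.Forall₂.cons (by decide) (List.Forall₂.cons (by decide) List.Forall₂.nil))
    (by decide)

end TableauEval

end Literature.Computability.AlgebraicComplexity
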